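import Mathlib.MeasureTheory.Integral.IntervalIntegral.Basic
import Literature.Analysis.FunctionSpaces.TorusFluidGlue
import Literature.Analysis.FunctionSpaces.HolderNorm
import Literature.Analysis.FluidPDE.WeakSolution
import Literature.Analysis.FluidPDE.AnomalousDissipation
import HarnessLib

/-!
# Barrier (AnomalousDissipation): anomalous dissipation of the vanishing-viscosity limit without
dissipation anomaly (Cheskidov 2023)
(D-0021 barrier catalogue for `Summits/AnomalousDissipation`; summit statement
`AnomalousDissipation := Literature.Turb.ZerothLaw`)

A. Cheskidov, *Dissipation anomaly and anomalous dissipation in incompressible fluid flows*,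
arXiv:2311.04182 (2023). Terminology of the source (Def. 1.1, reversed with respect to the name
of this problem directory): a vanishing-viscosity family `u^ν` of solutions of the forced
Navier–Stokes equations on `[0,2] × T³` exhibits **dissipation anomaly** on `[0,t]` if
`D(t) := limsup_{ν→0} 2ν∫₀ᵗ‖∇u^ν‖²_{L²} > 0` (this is the `ε`-form used throughout the tree:
`Torus.cumulativeDissipation`, `Literature.Analysis.FluidPDE.HasAnomalousDissipation`, `Literature.Analysis.FluidPDE.meanDissipation`),
while the limiting weak Euler solution `u` exhibits **anomalous dissipation** on `[0,t]` if
`‖u_in‖²_{L²} + W(t) - ‖u(t)‖²_{L²} > 0`, `W(t) = 2∫₀ᵗ(f,u)` the work of the force. From the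
energy equality and weak convergence one only gets `‖u(t)‖² ≤ E(t) = ‖u_in‖² - D(t) + W(t)`
(op. cit. §1.1), so "dissipation anomaly automatically implies anomalous dissipation"; the
paper shows "that the converse is not true" (§1.1): Theorem 2.1 constructs a countable family
of smooth solutions of forced Navier–Stokes on `[0,2] × T³` with a common smooth datum `u_in`,
`‖u_in‖_{L²} = 1`, forces `f^ν → f` in `C([0,2]; C^α)` for every `0 < α < 1`, converging
strongly in `C([0,t]; L²)` for every `t < 1` to a weak Euler solution `u ∈ C_w([0,2]; L²)` with
force `f` and datum `u_in`, smooth on `[0,1) ∪ (1,2]`, which loses all of its energy at `t = 1`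
with zero work (`∫₀¹(f,u) = 0`, `u(t) = 0` on `[1,2]`); and, for the energy level `e = 0` of the
second subfamily, a subsequence `ν_j → 0` along which `u^{ν_j} → u` in `C_w([0,2]; L²)`, the
limiting energy is `E(t) = lim_j ‖u^{ν_j}(t)‖² = 1` on `[1,2]` and the dissipation vanishes,
`D(t) = 0` on `[0,2]` — "when `e = 0`, there is no dissipation anomaly …, while the limiting
solution of the Euler equation looses all of its energy exhibiting anomalous dissipation"
(Thm. 2.1, last sentence). The energy of the family escapes to infinite frequency
(`u^{ν_j}(t) ⇀ 0` with `‖u^{ν_j}(t)‖_{L²} → 1`, `t ∈ [1,2]`) instead of being dissipated by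
viscosity (§4: on `[1,2]` the third component solves the heat equation, Remark 2.3, and the
viscosities `ν_m = m⁻¹λ_m⁻²`, `λ_m = 5^m`, are too small to damp the mixed scalar).

## What is vendored

* `Cheskidov2023_thm21_noDissipationAnomaly` — the `e = 0` case of Thm. 2.1 (second subfamily)
  together with the clauses of the theorem common to the whole family, as an existential
  statement on the flat unit torus `T³ = UnitAddTorus (Fin 3)` in the accepted notions:
  classical solutions `Torus.IsClassicalNSSolutionOn (Icc 0 2)` (the constructed solutions are
  `2½`-dimensional with zero pressure, §3–§4), forced weak Euler solutions with datum
  `Torus.IsWeakNSSolutionForcedOn 2 0 f u_in u` (§4: "`u(t) = (v(t), ρ(t))` is a weak solution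
  of the Euler equation with force `f = (g,0)` and initial data `u(0) = u_in` on the extended
  time interval `[0,2]`"), Hölder norms `eBoundedHolderNorm` (`‖·‖_∞ + [·]_α`, accepted
  `HolderNorm`), `eLpNorm · 2 volume` on time slices, and `Torus.cumulativeDissipation ν u 0 t =
  ν∫₀ᵗ‖∇u‖²`. Convergence in `C_w([0,2]; L²)` is recorded slice-wise (weak `L²` convergence at
  every `t ∈ [0,2]`), which is what the energy-defect reading uses. The barrier block sits here.
* Proved corollary `Cheskidov2023_thm21_noDissipationAnomaly.exists_not_hasAnomalousDissipation`:
  the family of the fact is a vanishing-viscosity family of classical solutions whose weak Euler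
  limit loses all of its (unit) energy with zero work, yet `¬ Literature.Turb.HasAnomalousDissipation`
  (the accepted `ε`-form on the window `[0,1]`) — and the same on `[0,2]` in `Tendsto` form.

## References

* A. Cheskidov, arXiv:2311.04182 (2023): §1.1 (Def. 1.1 and the limiting energy inequality), Thm. 2.1 with Remarks 2.2–2.4,
  Thm. 2.5 (two limiting Euler solutions, one subsequence without and one with dissipation
  anomaly), Thm. 2.6 (conditional discontinuity of the limit), §3 (the datum `u_in`, the Euler solution `u` on `[0,1)` and its blow-up as `t → 1⁻`), Lemma 3.2,
  §4 (proof of Thm. 2.1), Remark 1.6 and Thm. 1.3 (long-time averages).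
* E. Bruè, C. De Lellis, Comm. Math. Phys. 400 (2023) (the `2½`-dimensional mixing framework
  followed by the source).
-/

open MeasureTheory Set Filter Topology
open scoped ENNReal NNReal InnerProductSpace RealInnerProductSpace

noncomputable section

namespace Literature.Barriers.AnomalousDissipation

/-- The flat three-torus `T³ = (ℝ/ℤ)³` (local notation). -/
local notation "𝕋³" => UnitAddTorus (Fin 3)
/-- Velocity values (local notation). -/
local notation "E³" => EuclideanSpace ℝ (Fin 3)

/-- **Anomalous dissipation without dissipation anomaly** (Cheskidov, arXiv:2311.04182, Thm. 2.1,
second subfamily with energy level `e = 0`, with the clauses common to the whole family). There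
exist a smooth datum `u_in` on `T³` with `‖u_in‖_{L²} = 1`, viscosities `ν_j > 0`, `ν_j → 0`,
smooth (classical) solutions `(u_j, p_j)` of the forced Navier–Stokes equations with viscosity
`ν_j` and force `f_j` on `[0,2] × T³` with `u_j(0) = u_in`, a force `f` with `f_j → f` in
`C([0,2]; C^α(T³))` for every `0 < α < 1`, and a weak solution `u` of the forced Euler equations
on `[0,2]` with force `f` and datum `u_in`, smooth (classical) on `[0,1)`, such that:
`u_j → u` in `C([0,t]; L²)` for every `t < 1`; `u_j(t) ⇀ u(t)` weakly in `L²` for every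
`t ∈ [0,2]` (the source: `u_j → u` in `C_w([0,2]; L²)`); the limit loses all of its energy at
`t = 1` with zero work — `u(t) = 0` for `t ∈ [1,2]`, `∫₀¹ (f,u) dt = 0` (the power input
`t ↦ (f(t),u(t))` being integrable on `(0,1)`: `f ∈ C([0,2];C^α)`, `u ∈ C_w([0,2];L²)` is bounded
in `L²`; recorded to keep the interval integral genuine) — i.e. `u` dissipates anomalously on
`[0,2]` in the sense of Def. 1.1; and yet there is **no dissipation anomaly**: the energies of the
family stay at `lim_j ‖u_j(t)‖²_{L²} = 1` for `t ∈ [1,2]` ("hence `u^{ν_j}(t)` does not converge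
strongly in `L²` to `u(t)` for every `t ∈ [1,2]`") and `ν_j ∫₀ᵗ ‖∇u_j‖²_{L²} → 0` for every
`t ∈ [0,2]` (`D ≡ 0`).

BARRIER (D-0021):
- technique_class: euler-limit vanishing-viscosity-limit weak-convergence energy-defect dissipative-euler-solution anomalous-dissipation-of-the-limit weak-euler-energy-balance compactness
- blocks: finite-window inferences of the form "the vanishing-viscosity (weak) limit `u` of a forced Navier–Stokes family is a weak Euler solution violating the energy balance ⇒ the family dissipates anomalously in the `ε`-form `liminf ν∫₀ᵀ‖∇u^ν‖² > 0`" (`Literature.Analysis.FluidPDE.HasAnomalousDissipation`, the form of `Literature.Turb.BrueDeLellisQuestion21/22` and, after time-averaging, of `Literature.Analysis.FluidPDE.meanDissipation` in the summit `Literature.Turb.ZerothLaw`): for the family of Thm. 2.1 the limit loses all of its energy with zero work while `2ν_j∫₀²‖∇u^{ν_j}‖² → 0` — "dissipation anomaly automatically implies anomalous dissipation … the converse is not true" [cite: Cheskidov2023, §1.1 and Thm. 2.1]; the same datum and forces even admit two distinct limiting weak Euler solutions reached along two subsequences, one without and one with (total) dissipation anomaly [cite: Cheskidov2023, Thm. 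2.5].
- because: weak `L²` convergence and the energy equality give only `‖u(t)‖² ≤ E(t) = ‖u_in‖² − D(t) + W(t)` [cite: Cheskidov2023, §1.1]; in the `2½`-dimensional construction a planar field mixes the third component to frequency `λ_m = 5^m` as `t → 1` and vanishes on `[1,2]`, where the third component solves the heat equation with `f^ν = 0` [cite: Cheskidov2023, §3–§4 and Remark 2.3]; for viscosities `ν_m = m⁻¹λ_m⁻²` the diffusion cannot damp the mixed scalar before `t = 2`, so `‖θ^m(2)‖_{L²} → ‖ρ^m(2)‖_{L²} = 1` and "there is no dissipation anomaly on the whole interval `[0,2]`", while `u^{ν}(t) ⇀ 0 = u(t)`: the energy missing from the limit sits in the failure of strong convergence (escape to infinite frequency), not in viscous dissipation [cite: Cheskidov2023, §4].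
- evasions_known: work with the viscous dissipation itself — along other subsequences of the same family the dissipation anomaly takes every value `e ∈ [0,1]` [cite: Cheskidov2023, Thm. 2.1], and for long-time averages of smooth time-periodic solutions with `f^{ν_j} → f` in `C(ℝ;L²)` total dissipation anomaly saturating the Doering–Foias bound is constructed (`Literature.Analysis.FluidPDE.cheskidov_time_periodic_anomaly`) [cite: Cheskidov2023, Thm. 1.3]; or secure strong `L²` convergence / convergence of the energy, under which the limiting energy inequality of §1.1 is an identity and the two notions coincide (as on `[0,1)` here, where `u^ν → u` in `C([0,t];L²)` and `D(t) = 0`) [cite: Cheskidov2023, §1.1 and Thm. 2.1]; under long-time averaging the mean dissipation of smooth solutions equals the mean work `⟨(u^ν,f^ν)⟩` (`≤` for Leray–Hopf solutions), so that "the dissipation anomaly is only possible when there is an injection of the energy" and is read off the work of the limit in Thm. 1.3 [cite: Cheskidov2023, Remark 1.6]; quantitatively, every `ν`-uniform bound strong enough for `L²` compactness restores the equivalence: uniform bounds in `L³(0,T;B^σ_{3,∞})` for some `σ > 0` together with `f^ν → f` in `L²(0,T;L²)` give strong `L³` subsequential limits `u` with `D[u] = lim_{ν→0} ε[u^ν]`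 as space–time distributions — the total dissipation measures of the family converge to the Duchon–Robert defect of the limit, so the two notions coincide shell by shell (strong `L²_{t,x}` pre-compactness already from uniform `L²_t B^σ_{2,∞}` bounds, Aubin–Lions–Simon) [cite: DrivasEyink2019, Thm. 2 (i) and Remark 3]; conversely, for a weak-* limit with `f^ν → f` strongly in `L²_tL²_x`, energy balance of the limit on `[0,T]` forces `u^ν → u` strongly in `L²(0,T;L²)` in any dimension (weak lower semicontinuity plus the limiting energy inequality) [cite: JinEtAl2025, Prop. 3.8 and Remark 3.9] (in `d = 2` the two are equivalent, [cite: JinEtAl2025, Thm. 2.8]) — so on a finite window the alternative "strong convergence, and then anomalous dissipation of the limit = dissipation anomaly" versus "an energy defect `E(t) − ‖u(t)‖² > 0` of the weak limit not accounted for by `D`" is exhaustive, and a route must say which side it is on (audit 2026-08-15).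
- scope_caveats: (a) an existence theorem on the finite window `[0,2]` with `ν`-dependent forces `f^ν → f` in `C([0,2];C^α)`, `α < 1` (vanishing on `[1,2]`), one common smooth datum and smooth solutions; it exhibits one family for which anomalous dissipation of the limit comes without dissipation anomaly — it does not assert that this happens for every family, and says nothing about `ν`-independent or time-independent forces, Leray–Hopf (non-smooth) families, or the long-time-average framework of the summit `Literature.Turb.ZerothLaw`, where dissipation balances work [cite: Cheskidov2023, Remark 1.6]; (b) the vendored clauses are a sub-list of the printed ones: convergence in `C_w([0,2];L²)` is recorded as weak `L²` convergence at each `t ∈ [0,2]`, the absolutely continuous limiting energy profile, the countability of the family and the statements for `e ∈ (0,1)` and for the first subfamily are not transcribed, and the clause "`‖u(1)‖²_{L²} = ‖u_in‖²_{L²} = 1`" printed in the first display of Thm. 2.1 next to "`u(t) = 0` for `t ∈ [1,2]`" is read, with the blow-up display of §3 (`lim_{t→1⁻}‖u(t)‖_{L²} = 1`, `u(t) ⇀ 0`) and the `E(t)` display of Thm. 2.1, as the left limit `lim_{t→1⁻}‖u(t)‖²_{L²} = 1` and is not transcribed either; (c) the integrability guard on `t ↦ (f(t),u(t))` over `(0,1)`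 is implied by, but not printed in, the source (`f ∈ C([0,2];C^α)`, `u ∈ C_w([0,2];L²)`); (d) regularity and time profile of the witness (audit 2026-08-15): the forces converge in `C([0,2];C^α)` for `α < 1` only — the limiting force `f = (g,0)` is not uniformly Lipschitz — and the stirring is truncated `ν`-dependently (the member with viscosity `ν` carries the `𝔪(ν)`-stage drift `v^{𝔪(ν)}`, so `f^ν ≠ f`) [cite: Cheskidov2023, §4, Conclusion of the proof of Thm. 2.1]; before `t = 1` the limit `u = (ṽ, ρ̃)` runs through every quasi-self-similar stage: on the `n`-th stage `[t_n, t_{n+1})`, `t_n = 1 − (n+1)⁻²` (length `∼ 2n⁻³`), `ρ̃(t)` is a time-rescaled `ρ_n` with `‖ρ_n(s)‖_{L²} = 1` and `‖ρ_n(s)‖_{Ḣ⁻¹} ≤ Cλ_n⁻¹`, `λ_n = 5ⁿ` [cite: Cheskidov2023, Thm. 3.1 (b) and (3.4)–(3.8)], whence (a two-line computation, not printed) `‖u(t)‖_{B^α_{2,∞}} ≳_α 5^{nα}` there and `u ∉ L^p(0,1; B^α_{2,∞})` for every `α > 0`, `p ≥ 1` (`Σ n⁻³5^{npα} = ∞`):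 the limit is Onsager-supercritical of every order, loses ALL of its energy by a jump at the single instant `t = 1` at which `u(t) ⇀ 0` [cite: Cheskidov2023, (3.10)], and on `[1,2]` the family's unit energy is carried by `θ^m(t) ≈ ρ^m(1)` with `‖ρ^m(1)‖_{Ḣ⁻¹} ≤ Cλ_m⁻¹` [cite: Cheskidov2023, (3.6), and (4.3) with the viscosities (4.19)], so `{u^{ν_j}}` is bounded in no `L^p(1,2;B^α_{2,∞})`, `α > 0`. Nothing is witnessed for weak limits of positive Besov/Hölder regularity, for energy losses of the limit continuous in time, or for families obeying `ν`-uniform inertial-range bounds; but every `ν`-uniform bound strong enough for `L²` compactness makes the notions coincide (evasions above), so a finer witness would have to lose compactness while keeping the limit Hölder — and whether a vanishing-viscosity limit of (NSE) can at all be a Hölder (convex-integration type) dissipative Euler solution is open [cite: CheskidovPeng2025, Remark 1.5] (the same source restates the dichotomy and the counterexample [cite: CheskidovPeng2025, Def. 1.4 and the paragraph after it]); (e) Def. 1.1 takes `D` as a `limsup` and `E` as a `liminf` over the whole family `ν → 0` [cite: Cheskidov2023, §1.1, Def. 1.1]; over the whole countable family of Thm. 2.1 the `limsup`-dissipation is total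 on `(1,2]` (first subfamily, `D(t) = 1`), and "no dissipation anomaly" is the property of the `e = 0` subsequence `ν⁰_j` [cite: Cheskidov2023, Thm. 2.1 and Remark 2.2] — itself a vanishing-viscosity family, which is what the decl's `ν : ℕ → ℝ` records; the tree's `ε`-form `Literature.Analysis.FluidPDE.HasAnomalousDissipation` is the `liminf`-along-a-sequence form and is insensitive to the distinction after passing to subsequences (as the summit's `∃ ν_j` does); (f) the inverse-cascade variant shows the same gap with strong convergence restored after the singular time: along `ν¹_j` of Thm. 2.5 the limit `u₁` is energy balanced on `[0,1) ∪ (1,2]` with `u₁(1) = 0`, `u^{ν¹_j} → u₁` in `C([t,2];L²)` for `t > 1`, and `2ν¹_j∫₀²‖∇u^{ν¹_j}‖² → 0` [cite: Cheskidov2023, Thm. 2.5] — energy sent to infinite frequency and brought back, never dissipated; for PASSIVE scalars this "variance lost and regained" is realised with a `ν`-INDEPENDENT bounded divergence-free drift on `T²`, every bounded datum and a unique vanishing-viscosity limit, perfectly mixed on `[42,58]` and unmixed again at `t = 100` with `f^ν → f` in `C⁰([58+ε,100];L^p)`, `f(·,100) = f₀` [cite: HuysmansTiti2025, Thm. 6.7]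 (hence, by the scalar energy identity, `2ν∫₀^{100}‖∇f^ν‖² → 0` along the whole family while the limit has lost all of its variance on `[42,58]`): `ν`-independence of the stirring is no obstruction to the mechanism, but that drift is only `L^∞` and not a Navier–Stokes flow, so this is not a statement about (NSE) and leaves (a) untouched.
- status: established (theorem) [cite: Cheskidov2023, Thm. 2.1] -/
def Cheskidov2023_thm21_noDissipationAnomaly : Prop :=
  ∃ (u_in : 𝕋³ → E³) (ν : ℕ → ℝ) (fs us : ℕ → ℝ → 𝕋³ → E³) (ps : ℕ → ℝ → 𝕋³ → ℝ)
    (f u : ℝ → 𝕋³ → E³),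
    -- the Navier–Stokes family: smooth solutions on `[0,2]` from the common smooth unit-energy datum
    Literature.Analysis.FunctionSpaces.Torus.IsSmooth u_in ∧ eLpNorm u_in 2 volume = 1 ∧
    (∀ j, 0 < ν j) ∧ Tendsto ν atTop (𝓝 0) ∧
    (∀ j, Literature.Analysis.FunctionSpaces.Torus.IsClassicalNSSolutionOn (Icc 0 2) (ν j) (fs j) (us j) (ps j) ∧ us j 0 = u_in) ∧
    -- the forces converge in `C([0,2]; C^α(T³))` for every `0 < α < 1`
    (∀ α : ℝ≥0, 0 < α → α < 1 →
      Tendsto (fun j => ⨆ t ∈ Icc (0 : ℝ) 2, Literature.Analysis.FunctionSpaces.eBoundedHolderNorm α (fs j t - f t)) atTop (𝓝 0)) ∧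
    -- the limit: a weak Euler solution with force `f` and datum `u_in` on `[0,2]`, classical on `[0,1)`
    Literature.Analysis.FluidPDE.Torus.IsWeakNSSolutionForcedOn 2 0 f u_in u ∧
    (∃ p : ℝ → 𝕋³ → ℝ, Literature.Analysis.FunctionSpaces.Torus.IsClassicalNSSolutionOn (Ico 0 1) 0 f u p) ∧
    -- strong convergence in `C([0,t]; L²)` for every `t < 1`
    (∀ t ∈ Ico (0 : ℝ) 1,
      Tendsto (fun j => ⨆ s ∈ Icc (0 : ℝ) t, eLpNorm (us j s - u s) 2 volume) atTop (𝓝 0)) ∧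
    -- weak `L²` convergence at every time of `[0,2]`
    (∀ t ∈ Icc (0 : ℝ) 2, ∀ w : 𝕋³ → E³, MemLp w 2 volume →
      Tendsto (fun j => ∫ x, ⟪us j t x, w x⟫) atTop (𝓝 (∫ x, ⟪u t x, w x⟫))) ∧
    -- anomalous dissipation of the limit: all energy lost at `t = 1`, with zero work
    (∀ t ∈ Icc (1 : ℝ) 2, u t = 0) ∧
    IntervalIntegrable (fun t => ∫ x, ⟪f t x, u t x⟫) volume 0 1 ∧
    (∫ t in (0 : ℝ)..1, ∫ x, ⟪f t x, u t x⟫) = 0 ∧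
    -- … without dissipation anomaly: the energies stay at `1` on `[1,2]` and `D ≡ 0` on `[0,2]`
    (∀ t ∈ Icc (1 : ℝ) 2, Tendsto (fun j => eLpNorm (us j t) 2 volume) atTop (𝓝 1)) ∧
    (∀ t ∈ Icc (0 : ℝ) 2,
      Tendsto (fun j => Literature.Analysis.FunctionSpaces.Torus.cumulativeDissipation (ν j) (us j) 0 t) atTop (𝓝 0))

/-- **Corollary (`ε`-form).** The family of `Cheskidov2023_thm21_noDissipationAnomaly` is a
vanishing-viscosity family of classical forced Navier–Stokes solutions from a common unit-energy
datum whose weak Euler limit loses all of its energy by `t = 1` with zero work of the force,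
and which nevertheless has **no** anomalous dissipation in the accepted `ε`-form
`Literature.Analysis.FluidPDE.HasAnomalousDissipation` (window `[0,1]`), nor on the full window:
`ν_j∫₀²‖∇u_j‖² → 0` (Cheskidov, arXiv:2311.04182, Thm. 2.1, "`e = 0`": "there is no dissipation
anomaly …, while the limiting solution of the Euler equation looses all of its energy").
Proved from the named fact via `Literature.Analysis.FluidPDE.not_hasAnomalousDissipation_of_tendsto_zero`.
[cite: Cheskidov2023, Thm. 2.1] -/
theorem Cheskidov2023_thm21_noDissipationAnomaly.exists_not_hasAnomalousDissipation
    (h : Cheskidov2023_thm21_noDissipationAnomaly) :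
    ∃ (u_in : 𝕋³ → E³) (ν : ℕ → ℝ) (fs us : ℕ → ℝ → 𝕋³ → E³) (ps : ℕ → ℝ → 𝕋³ → ℝ)
      (f u : ℝ → 𝕋³ → E³),
      eLpNorm u_in 2 volume = 1 ∧ (∀ j, 0 < ν j) ∧ Tendsto ν atTop (𝓝 0) ∧
      (∀ j, Literature.Analysis.FunctionSpaces.Torus.IsClassicalNSSolutionOn (Icc 0 2) (ν j) (fs j) (us j) (ps j) ∧ us j 0 = u_in) ∧
      Literature.Analysis.FluidPDE.Torus.IsWeakNSSolutionForcedOn 2 0 f u_in u ∧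
      (∀ t ∈ Icc (0 : ℝ) 2, ∀ w : 𝕋³ → E³, MemLp w 2 volume →
        Tendsto (fun j => ∫ x, ⟪us j t x, w x⟫) atTop (𝓝 (∫ x, ⟪u t x, w x⟫))) ∧
      (∀ t ∈ Icc (1 : ℝ) 2, u t = 0) ∧
      (∫ t in (0 : ℝ)..1, ∫ x, ⟪f t x, u t x⟫) = 0 ∧
      ¬ Literature.Analysis.FluidPDE.HasAnomalousDissipation ν us ∧
      Tendsto (fun j => Literature.Analysis.FunctionSpaces.Torus.cumulativeDissipation (ν j) (us j) 0 2) atTop (𝓝 0) := by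
  obtain ⟨u_in, ν, fs, us, ps, f, u, _hsm, hnorm, hν, hν₀, hNS, _hforce, hEuler, _hclass,
    _hstrong, hweak, hzero, _hint, hwork, _henergy, hD⟩ := h
  refine ⟨u_in, ν, fs, us, ps, f, u, hnorm, hν, hν₀, hNS, hEuler, hweak, hzero, hwork, ?_, ?_⟩
  · exact Literature.Analysis.FluidPDE.not_hasAnomalousDissipation_of_tendsto_zero
      (hD 1 ⟨zero_le_one, one_le_two⟩)
  · exact hD 2 ⟨zero_le_two, le_rfl⟩

end Literature.Barriers.AnomalousDissipation

end
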